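import Mathlib
import HarnessLib
import Summits.Ventures.LatticeQCDFlow.Exactness.SphereFlowResidualAction

/-!
# Liouville's formula in differential form, `(d/dc) ℓ_{s→c}(x) = −Σ_n∂̃_n·∂̃_nG_c(Φ_{s→c}x)`, the Jacobian cocycle `ℓ_{s→c} = ℓ_{s→u} + ℓ_{u→c}∘Φ_{s→u}`, and Lüscher's eq. (3.9): the effective action `cS∘Φ_{s→c} − ℓ_{s→c}` moves at the rate of the residual `(S − 𝓛_cG_c)∘Φ_{s→c}`

HONEST FRAMING: exact (Metropolis-corrected) sampling algorithms for lattice gauge theory;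
figures of merit are autocorrelation/cost numbers at stated couplings and volumes; no
continuum-physics claim.

Venture `LatticeQCDFlow` (cell pub-lqcd), topic `Exactness`; FANOUT row 7 (`s0-cpn-null`: the
S0-D1 rung — 2D CP⁹, Lüscher's LO trivializing map inside HMC, Engel–Schaefer 2011).  NEW WORK of
the cell over the tree's `Exactness/SphereFlowLiouville.lean` / `SphereFlowResidualAction.lean`
(this leg: the log-Jacobian `ℓ_{s→c} = sphereTDFlowLogJac`, Liouville's theorem in weak form, the
effective action as the integrated residual) and `Exactness/SphereTimeDependentFlow.lean` (GEN-14: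
Chapman–Kolmogorov, the true equation in the window); nothing is cited as a fact.  Printed
counterpart, NAMED ONLY: M. Lüscher, Commun. Math. Phys. 293 (2010) 899, §3.2 eq. (3.7)
`(d/dt) ln det Φ_t^* = −Σ(∂∂S̃_t)∘Φ_t` and eq. (3.9) `(d/dt){S(Φ_t) − ln det Φ_t^*} = {S − 𝓛_tS̃_t}∘Φ_t`
up to constants (with (4.5)).

* §1 **THE JACOBIAN COCYCLE**: `ℓ_{s→c}(x) = ℓ_{s→u}(x) + ℓ_{u→c}(Φ_{s→u}x)`
  (**`sphereTDFlowLogJac_trans`**, Chapman–Kolmogorov for the Jacobian: `J_{s→c} = J_{s→u}·J_{u→c}∘Φ_{s→u}`)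
  and `ℓ_{c→s}(Φ_{s→c}x) = −ℓ_{s→c}(x)` (**`sphereTDFlowLogJac_symm`**: the inverse map has the
  inverse Jacobian);
* §2 **LIOUVILLE'S FORMULA IN DIFFERENTIAL FORM** (**`hasDerivAt_sphereTDFlowLogJac_final`**): for
  `x ∈ Ω̃` and every real `c`, `(d/dc) ℓ_{s→c}(x) = −Σ_n∂̃_n·∂̃_nG_c(Φ_{s→c}x)` — the logarithmic
  Jacobian changes at the rate of the divergence `div(−∂̃G_c) = −Σ∂̃²G_c` of the generating field at
  the current point (Lüscher's (3.7));
* §3 **LÜSCHER'S EQ. (3.9)** (**`hasDerivAt_mul_action_comp_sub_sphereTDFlowLogJac`**): for `x ∈ Ω̃`,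
  `S ∈ C¹` and `|c| ≤ |T| + 1`,
  `(d/dc) [c·S(Φ_{s→c}x) − ℓ_{s→c}(x)] = (S − 𝓛_cG_c)(Φ_{s→c}x)`:
  the effective action of the flowed theory is stationary in the flow time exactly when the residual
  of the flow equation vanishes up to a constant — the infinitesimal form of the trivialization
  criterion, now WITH the Jacobian term.

NOT CLAIMED: anything quantitative; generators only jointly `C²`; autocorrelations or the rung's
numbers.
-/

noncomputable section

namespace Summit.Ventures.LatticeQCDFlow.Exactness

open Function Set Metric MeasureTheory NormedSpace InnerProductSpace
open scoped RealInnerProductSpace Topology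

variable {Λ : Type*} {E : Type*} [NormedAddCommGroup E] [InnerProductSpace ℝ E]
  [FiniteDimensional ℝ E] [Fintype Λ] [DecidableEq Λ] {G : ℝ → (Λ → E) → ℝ} {T : ℝ}

/-! ## §1 The Jacobian cocycle -/

/-- The cut-off Laplacian along a flow line is continuous in the time (jointly `C³` generator). -/
theorem continuous_sphereCutoff_mul_sum_siteLaplacian_sphereTDFlow
    (hG : ContDiff ℝ 2 fun q : ℝ × (Λ → E) => G q.1 q.2)
    (hG3 : ContDiff ℝ 3 fun q : ℝ × (Λ → E) => G q.1 q.2) (s : ℝ) (x : Λ → E) :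
    Continuous fun u : ℝ => sphereCutoff (sphereTDFlow hG T s u x) *
      ∑ n, siteLaplacian n (G u) (sphereTDFlow hG T s u x) := by
  have hF := (contDiff_sphereCutoff_mul_sum_siteLaplacian_comp_sphereTDFlow hG hG3 (T := T)).continuous
  have hj : Continuous fun u : ℝ => ((u, (s, x)) : ℝ × (ℝ × (Λ → E))) :=
    continuous_id.prodMk continuous_const
  have h := hF.comp hj
  exact h

/-- **THE JACOBIAN COCYCLE** (Chapman–Kolmogorov for the log-Jacobian): for all real `s`, `u`, `c`,
`ℓ_{s→c}(x) = ℓ_{s→u}(x) + ℓ_{u→c}(Φ_{s→u}x)`, i.e. `J_{s→c} = J_{s→u}·(J_{u→c}∘Φ_{s→u})`. -/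
theorem sphereTDFlowLogJac_trans (hG : ContDiff ℝ 2 fun q : ℝ × (Λ → E) => G q.1 q.2)
    (hG3 : ContDiff ℝ 3 fun q : ℝ × (Λ → E) => G q.1 q.2) (s u c : ℝ) (x : Λ → E) :
    sphereTDFlowLogJac hG T s c x =
      sphereTDFlowLogJac hG T s u x + sphereTDFlowLogJac hG T u c (sphereTDFlow hG T s u x) := by
  have hfc := continuous_sphereCutoff_mul_sum_siteLaplacian_sphereTDFlow hG hG3 s x (T := T)
  rw [sphereTDFlowLogJac_sphereTDFlow, sphereTDFlowLogJac, sphereTDFlowLogJac,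
    ← intervalIntegral.integral_add_adjacent_intervals (hfc.intervalIntegrable s u)
      (hfc.intervalIntegrable u c)]
  ring

/-- **The inverse map has the inverse Jacobian**: `ℓ_{c→s}(Φ_{s→c}x) = −ℓ_{s→c}(x)`. -/
theorem sphereTDFlowLogJac_symm (hG : ContDiff ℝ 2 fun q : ℝ × (Λ → E) => G q.1 q.2)
    (hG3 : ContDiff ℝ 3 fun q : ℝ × (Λ → E) => G q.1 q.2) (s c : ℝ) (x : Λ → E) :
    sphereTDFlowLogJac hG T c s (sphereTDFlow hG T s c x) = -sphereTDFlowLogJac hG T s c x := by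
  have h := sphereTDFlowLogJac_trans hG hG3 s c s x (T := T)
  rw [sphereTDFlowLogJac_self] at h
  linarith

/-! ## §2 Liouville's formula in differential form -/

/-- **LIOUVILLE'S FORMULA, DIFFERENTIAL FORM** (Lüscher's (3.7) on the lattice of site spheres): for
a jointly `C³` generator, `x ∈ Ω̃` and all real `s`, `c`,
`(d/dc) ℓ_{s→c}(x) = −Σ_n∂̃_n·∂̃_nG_c(Φ_{s→c}x)` — the log-Jacobian of the evolution map changes at
the rate of the divergence of the generating field `−∂̃G_c` evaluated at the current point. -/
theorem hasDerivAt_sphereTDFlowLogJac_final (hG : ContDiff ℝ 2 fun q : ℝ × (Λ → E) => G q.1 q.2)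
    (hG3 : ContDiff ℝ 3 fun q : ℝ × (Λ → E) => G q.1 q.2) (s : ℝ) {x : Λ → E}
    (hx : ∀ n, ‖x n‖ = 1) (c : ℝ) :
    HasDerivAt (fun c' => sphereTDFlowLogJac hG T s c' x)
      (-∑ n, siteLaplacian n (G c) (sphereTDFlow hG T s c x)) c := by
  have hfc := continuous_sphereCutoff_mul_sum_siteLaplacian_sphereTDFlow hG hG3 s x (T := T)
  have h := (intervalIntegral.integral_hasDerivAt_right (hfc.intervalIntegrable s c)
    hfc.aestronglyMeasurable.stronglyMeasurableAtFilter hfc.continuousAt).neg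
  refine h.congr_deriv ?_
  rw [sphereCutoff_eq_one (norm_sphereTDFlow_eq_one hG s hx c), one_mul]

/-- The Jacobian itself: `(d/dc) e^{ℓ_{s→c}(x)} = −(Σ_n∂̃_n·∂̃_nG_c(Φ_{s→c}x))·e^{ℓ_{s→c}(x)}` on `Ω̃`. -/
theorem hasDerivAt_exp_sphereTDFlowLogJac_final (hG : ContDiff ℝ 2 fun q : ℝ × (Λ → E) => G q.1 q.2)
    (hG3 : ContDiff ℝ 3 fun q : ℝ × (Λ → E) => G q.1 q.2) (s : ℝ) {x : Λ → E}
    (hx : ∀ n, ‖x n‖ = 1) (c : ℝ) :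
    HasDerivAt (fun c' => Real.exp (sphereTDFlowLogJac hG T s c' x))
      (-(∑ n, siteLaplacian n (G c) (sphereTDFlow hG T s c x)) *
        Real.exp (sphereTDFlowLogJac hG T s c x)) c := by
  have h := (hasDerivAt_sphereTDFlowLogJac_final hG hG3 s hx c (T := T)).exp
  refine h.congr_deriv ?_
  ring

/-! ## §3 Lüscher's eq. (3.9): the effective action moves at the rate of the residual -/

/-- **LÜSCHER'S EQ. (3.9) ON THE LATTICE OF SITE SPHERES.**  For a jointly `C³` generator, `S ∈ C¹`,
`x ∈ Ω̃`, every real `s` and `|c| ≤ |T| + 1` (the window where the flow is `ẋ = −∂̃G_c(x)`):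
`(d/dc) [c·S(Φ_{s→c}x) − ℓ_{s→c}(x)] = S(Φ_{s→c}x) − 𝓛_cG_c(Φ_{s→c}x)`
— the effective (pulled-back minus log-Jacobian) action of the flowed theory is stationary in the
flow time, up to `x`-independent constants, exactly when `G_c` solves the flow equation
`𝓛_cG_c = S + C_c`. -/
theorem hasDerivAt_mul_action_comp_sub_sphereTDFlowLogJac
    (hG : ContDiff ℝ 2 fun q : ℝ × (Λ → E) => G q.1 q.2)
    (hG3 : ContDiff ℝ 3 fun q : ℝ × (Λ → E) => G q.1 q.2) {S : (Λ → E) → ℝ} (hS : ContDiff ℝ 1 S)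
    (s : ℝ) {x : Λ → E} (hx : ∀ n, ‖x n‖ = 1) {c : ℝ} (hc : |c| ≤ |T| + 1) :
    HasDerivAt (fun c' => c' * S (sphereTDFlow hG T s c' x) - sphereTDFlowLogJac hG T s c' x)
      (S (sphereTDFlow hG T s c x) - sphereLuscherL S c (G c) (sphereTDFlow hG T s c x)) c := by
  have h1 := hasDerivAt_mul_action_comp_sphereTDFlow hG hS s hx hc (T := T)
  have h2 := hasDerivAt_sphereTDFlowLogJac_final hG hG3 s hx c (T := T)
  refine (h1.sub h2).congr_deriv ?_
  rw [sphereLuscherL_apply]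
  ring

/-- **The integrated form recovered by the fundamental theorem of calculus** (consistency with
`mul_action_comp_sub_sphereTDFlowLogJac_eq_intervalIntegral`): for `|s|, |c| ≤ |T| + 1`,
`c·S(Φ_{s→c}x) − ℓ_{s→c}(x) − s·S(x) = ∫_s^c (S − 𝓛_uG_u)(Φ_{s→u}x) du`. -/
theorem mul_action_comp_sub_sphereTDFlowLogJac_sub_eq_intervalIntegral
    (hG : ContDiff ℝ 2 fun q : ℝ × (Λ → E) => G q.1 q.2)
    (hG3 : ContDiff ℝ 3 fun q : ℝ × (Λ → E) => G q.1 q.2) {S : (Λ → E) → ℝ} (hS : ContDiff ℝ 1 S)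
    {x : Λ → E} (hx : ∀ n, ‖x n‖ = 1) {s c : ℝ} (hs : |s| ≤ |T| + 1) (hc : |c| ≤ |T| + 1) :
    c * S (sphereTDFlow hG T s c x) - sphereTDFlowLogJac hG T s c x - s * S x =
      ∫ u in s..c, (S (sphereTDFlow hG T s u x) -
        sphereLuscherL S u (G u) (sphereTDFlow hG T s u x)) := by
  rw [← mul_action_comp_sub_sphereTDFlowLogJac_eq_intervalIntegral hG hG3 hS hx hs hc]
  ring

end Summit.Ventures.LatticeQCDFlow.Exactness

end
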